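import Literature.NumberTheory.EllipticCurves.Kato2004.BigImageDivisibilityCyclotomicPrime
import Literature.NumberTheory.EllipticCurves.SelmerRestrictionCorankRelative
import Literature.NumberTheory.EllipticCurves.PAdicBSD
import HarnessLib

/-!
# Kato 2004, Thm. 17.4 (3) for an odd prime `p` (big `p`-adic image), the SINGLE component
# `i = (p−1)/2`: `char_{Λ(Γ)} e_{(p−1)/2}X(E/ℚ(ζ_{p^∞})) ∋ u · L_p(E, ω^{(p−1)/2}, T)`, read on the
# `χ_{ℚ(√p*)}`-eigenspace of `Sel_{p^∞}(E/ℚ(μ_{p^∞}))` in the subgroup model over `Γ_ℚ`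

Source: K. Kato, *`p`-adic Hodge theory and values of zeta functions of modular forms*, Astérisque
**295** (2004) 117–290 [Kato2004Asterisque], **Theorem 17.4 (3)** (p. 273), with §17.3 (p. 273: the
Selmer group `Sel_∞(T) = lim_n Sel(ℚ(ζ_{p^n}), T(r))(−r)` over the full cyclotomic tower and its dual
`X(T)` "as a module over `Λ = O_λ⟦G_∞⟧`"), §12.1 (pp. 219–220: `G_∞ = Gal(ℚ(ζ_{p^∞})/ℚ)`,
`κ : G_∞ ≅ ℤ_p^×`, `Δ` "the torsion part of `G_∞`", (12.1.1) `O_L⟦G_∞⟧ = O_L[Δ]⟦G¹_∞⟧ ≅ O_L[Δ]⟦T⟧`,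
(12.1.3) "`O_L⟦G_∞⟧ ⊗ ℚ` is the product of the principal ideal domains `O_L⟦G_∞⟧_j ⊗ ℚ`", (12.1.4)
the height-one localisations), Thm. 12.5 (4) (p. 222: condition (12.5.2)), §17.5 (p. 274:
"good" `ω`, `γ`) and Thm. 16.2 (p. 269: `L_{p-adic,α,ω,γ}(f)` and its periods). ONE NAMED FACT
(`def … : Prop`, nothing asserted, D-0014): Theorem 17.4 (3) for `f = f_E` of weight `2`,
`F_λ = ℚ_p`, `T = T_pE(−1)`, on the ONE eigen-component `i = (p−1)/2` of
`Λ = ⊕_{i=0}^{p−2} Λ(Γ)e_i` — the component SIBLING of the all-branches PRODUCT reading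
`charIdeal_dvd_padicLFunction_cyclotomicPrime_of_surjective` (same printed sentences; that file
multiplies the `p − 1` component statements together, this one keeps the single component the
twist `E ⊗ (·/p)` needs). The same reading at `p = 3` (`i = 1`, two components) underlies the
`p = 3` sibling `charIdeal_dvd_padicLFunction_cyclotomicThree_of_surjective` (flag
`Kato-17.4-p3-branch-split`); here the flag family is `Kato-17.4-pgen-branch-split`, ONE component.

## The printed statements (held copy `paper:doi-10-24033-ast-639`, OCR-cleaned; pages re-read)

Thm. 17.4 (p. 273): "Assume `f` has good ordinary reduction at `λ`. Let `T` be a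
`Gal(ℚ̄/ℚ)`-stable `O_λ`-lattice of `V_{F_λ}(f)`. (1) `X(T)` is a torsion `Λ`-module. (2) Let `α` be as
in 17.1, let `ω` be a non-zero element of `S(f*)`, and let `γ` be an element of `V_F(f*)` such that
`γ⁺ ≠ 0` and `γ⁻ ≠ 0`. Then `L_{p-adic,α,ω,γ}(f) ∈ Λ ⊗ ℚ`, and we have
`length_{Λ_𝔭}(X(T)_𝔭) ≤ ord_𝔭(L_{p-adic,α,ω,γ}(f))` for any prime ideal `𝔭` in `Λ` of height one
which does not contain `p`. (3) Let `α, ω, γ` be as in (2), and assume that both `ω` and `γ` are good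
for some `Gal(ℚ̄/ℚ)`-stable `O_λ`-lattice of `V_{F_λ}(f)` in the sense of 17.5 below. Assume further
`p ≠ 2` and that the condition 12.5.2 in 12.5 (4) is satisfied. Then `L_{p-adic,α,ω,γ}(f)` belongs to
`Λ` and `length_{Λ_𝔭}(X(T)_𝔭) ≤ ord_𝔭(L_{p-adic,α,ω,γ}(f))` for any prime ideal `𝔭` of `Λ` of height
one." §17.3 (p. 273): "`X(T) = Hom_{O_λ}(Sel_∞(T), F_λ/O_λ)`. We regard `X(T)` as a module over
`Λ = O_λ⟦G_∞⟧`." (12.5.2) (p. 222): "There exists an `O_λ`-basis of `T` for which the image of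
`Gal(ℚ̄/ℚ(ζ_{p^∞})) → GL_{O_λ}(T) ≅ GL₂(O_λ)` contains `SL₂(ℤ_p)`." §17.5 (p. 274) and (14.18): good
`ω` (`ℤ_p`-basis of `coLie` of the Néron model) and good `γ` (bases of `T^±`).

## The reading — that of the product sibling, STOPPED ONE STEP EARLIER (no multiplication over `i`)

For `E/ℚ`, `p` odd good ordinary: `O_λ = ℤ_p`, `T = T_pE(−1)`, `X(T)` = the Pontryagin dual of
`Sel_{p^∞}(E/ℚ(ζ_{p^∞}))` as a `Λ = ℤ_p⟦G_∞⟧`-module, `G_∞ = Δ × Γ`, `#Δ = p − 1` prime to `p`,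
`Λ = ⊕_{i=0}^{p−2} Λ(Γ)e_i` (`e_i` the idempotent of `ω^i`, `ω` the Teichmüller character; Wuthrich
2014 §3 p. 390: "we split `M` up into the eigenspaces `M = ⊕_{i=0}^{p−2} M_i` where `Δ` acts on `M_i`
by the `i`-th power of the Teichmüller character"). The height-one primes of `Λ` are those of its
`p − 1` factors `Λ(Γ)e_i`, and localisation at a prime of the `i`-th factor sees `e_iX(T)` only; so
the printed inequality at EVERY height-one prime says, for EACH `i`:
`length_𝔭((e_iX)_𝔭) ≤ ord_𝔭(e_iL)` for all height-one `𝔭 ⊂ Λ(Γ)`, i.e. (`Λ(Γ)` a UFD, `e_iX`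
finitely generated torsion by 17.4 (1)) `char_{Λ(Γ)}(e_iX) ∣ e_iL`, i.e. `e_iL ∈ char_{Λ(Γ)}(e_iX)`.
THIS FACT is that statement for the single index `i = m := (p−1)/2`. The component `e_mL` of
`L_{p-adic,α,ω,γ}(f)` (Thm. 16.2; `ω` Néron, `γ` good: Néron periods up to `ℤ_p^×` and signs) is
the `ω^m`-branch of the Mazur–Swinnerton-Dyer measure, `L_p(E,ω^m,T)` (Mazur–Tate–Teitelbaum 1986
§I.13), on the PLUS modular symbols if `m` is even (`p ≡ 1 (mod 4)`; tree `padicLFunctionBranch f α m`)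
and on the MINUS symbols if `m` is odd (`p ≡ 3 (mod 4)`; tree `padicLFunctionMinusBranch f α m`);
in the tree's normalisation by the newform period of that parity (`ϖ·Ω_E = Ω⁺_f`, resp.
`ϖ·|Ω⁻(E)| = Ω⁻_f`) it is `u·ϖ·B_m`, `u ∈ ℤ_p^×` — ONE factor of the product sibling's
`u·ϖ^{m}ϖ'^{m}·∏_i B_i`.

THE MODULE `e_mX`, in the tree's SUBGROUP MODEL over `Γ_ℚ` (the convention of the tree's Iwasawa
theory, `WeierstrassCurve.selmerGroupOver`, `selmerInfty`; Greenberg LNM 1716 §1–2): let `κ` be the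
cyclotomic `ℤ_p`-extension of `ℚ` (`κ.IsCyclotomic`: `ker κ = Gal(ℚ̄/ℚ_∞)`), `F = ℚ(ζ_p)`
(`IsCyclotomicExtension {p} ℚ F`) and `K` the quadratic field with `θ² = p* = (−1)^{(p−1)/2}p` — the
unique quadratic subfield of `F` (Gauss: `p* = (∑_a (a/p)ζ_p^a)²`), so that inside `ℚ̄` the field
cut out by `H := ker κ ⊓ Gal(ℚ̄/K) ⊓ Gal(ℚ̄/F)` (`galRange`) is `ℚ_∞·K·F = ℚ_∞·F = ℚ(μ_{p^∞})`. Then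
`Sel_∞(T) = lim_n Sel(ℚ(ζ_{p^n}), T(1)) = Sel_{p^∞}(E/ℚ(μ_{p^∞}))` (Kato §14.1, §17.3) is
`V.selmerGroupOver p H` (classes of `H¹(H, E[p^∞])` with the local conditions at all places — the
SAME identification the product sibling makes with `selmerInfty` of the cyclotomic `ℤ_p`-extension
of the number field `ℚ(ζ_p)`: both are `Sel_{p^∞}(E/ℚ(μ_{p^∞}))`), and `G_∞ = Γ_ℚ/H` acts by the
conjugation action `conjH1`. `Δ` is the image of `ker κ = Gal(ℚ̄/ℚ_∞)` (as
`Gal(ℚ(μ_{p^∞})/ℚ_∞) ≅ Gal(F/ℚ) = Δ`), and `ω^m = ω^{(p−1)/2}` is the unique quadratic character of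
`Δ ≅ (ℤ/p)^×`, i.e. `ω^m(g) = +1` iff `g|_F` fixes the quadratic subfield `K`, iff
`g ∈ Gal(ℚ̄/K)`: so `e_m Sel_{p^∞}(E/ℚ(μ_{p^∞})) = {t : g_* t = ω^m(g) t ∀ g ∈ Δ}` is the subgroup
`S` of Selmer classes with `g_* t = t` for `g ∈ ker κ ∩ Gal(ℚ̄/K)` and `g_* t = −t` for
`g ∈ ker κ ∖ Gal(ℚ̄/K)` (hypothesis `hS` below, an `↔`), a direct summand (`p ∤ #Δ`), with
Pontryagin dual `e_mX(T)`. The `Λ(Γ)`-structure: `Γ = Gal(ℚ(μ_{p^∞})/F) ↔ 1 + pℤ_p`, `T = γ − 1`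
for the topological generator `γ ↔ 1 + p` (`cyclotomicGenerator p`); below `γ ∈ Γ_ℚ` lies in
`Gal(ℚ̄/K) ⊓ Gal(ℚ̄/F)`, `κ γ` generates (`IsTopGenerator`), and `χ_p(γ)·ζ = 1 + p` with `ζ`
torsion (`IsCyclotomicVariable p γ`; as `γ` fixes `ζ_p`, `χ_p(γ) ≡ 1 (mod p)` and `ζ = 1`), so `γ`
maps to Kato's generator of `Γ` and acts on `S` by `conjH1 γ` (hypothesis `hSγ`: `S` is
`γ_*`-stable). A `Λ`-dual datum of `S` is spelled out field by field exactly as the tree's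
`WeierstrassCurve.SelmerDualData` (Greenberg LNM 1716 §1 p. 60): an abstract `Λ = ℤ_p⟦T⟧`-module
`X` with a bijection `toDual : X ≅ Hom(S, ℚ/ℤ)`, `T` acting as `γ_* − 1`, constants through
`ℤ_p → ℤ/p^k` (the cell's sub-cell additive-p2 packages these fields as
`Summit.….Additive.ChiEigenSelmerInDualData`, gen 12, and proves in the kernel that every `Λ`-dual
datum of `Sel_{p^∞}(E ⊗ (·/p) / ℚ_∞)` gives one with the same module — the descent
`ℚ(μ_{p^∞}) → ℚ_∞(√p*) → ℚ_∞` is NOT part of this fact).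

Hypotheses transcribed: `E = V` globally minimal over `ℚ`, good ordinary at `p` (`IsOrdinaryAt V p`,
= 17.1 (i)); `p ≠ 2`; (12.5.2) as "`ρ̄_{E,p^n}` surjective for every `n`" (as in the product sibling
and in the tree's `kato_divisibility`, clause 3); `ω`, `γ` good — absorbed in the period
normalisation; `f` the newform of `E`, `α = unitRoot V p`. Conclusion: `X` (= `e_mX(T)`) is
`Λ`-torsion (17.4 (1), a direct summand of the torsion `X(T)`) and
`u·ϖ·B_m = ι g` for some `g ∈ char_Λ X`, `u ∈ ℤ_p^×`, `B_m` the `ω^m`-branch of the parity of `m`.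

What is NOT here: the other components `i ≠ (p−1)/2` (the product sibling carries all of them,
multiplied); `p = 2`; (12.5.2) in its printed generality; weight `k > 2`; any proof. No `_holds` is to
be expected.
-- TODO(general form): Thm. 17.4 (3) componentwise for every `i mod p − 1` and for lattices in
-- `V_{F_λ}(f)` of any ordinary newform of weight `k ≥ 2` under (12.5.2) "the image contains `SL₂(ℤ_p)`".

Consumer: the BSD rank-≤1 residual cell (`b2b-bsdres`), additive sub-cell: with additive-p1's kernel
transport `Sel_{p^∞}(E ⊗ χ_K/ℚ_∞) ≅ Sel_{p^∞}(E/K·ℚ_∞)^{(χ_K)}` (`TwistDescent`, `ChiEigenSelmerDual`)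
and additive-p2's kernel eigen-descent `ℚ(μ_{p^∞}) → ℚ_∞(√p*)` (`ChiEigenPrimeToPDescent*`), this
fact yields `char_Λ X(E^{(p*)}/ℚ_∞) ∋ u·ϖ·L_p(E, ω^{(p−1)/2}, T)` for the ADDITIVE twist `E^{(p*)}`
(classes X4♯(G-ord) / X4(M) with a good ordinary twist), i.e. the typed input
`ChiBranchLeadingTerm[Odd]BigImageAt` at every odd `p`.
-/

set_option autoImplicit false

noncomputable section

open scoped Classical MatrixGroups ModularForm

open CongruenceSubgroup WeierstrassCurve Literature.NumberTheory.EllipticCurves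
  Literature.NumberTheory.EllipticCurves.ModularForms
  Literature.NumberTheory.GaloisRepresentations

namespace Literature.NumberTheory.EllipticCurves.Kato2004

/-- **Kato 2004, Theorem 17.4 (3) for an odd prime `p` under `ρ_{E,p^∞}` onto, component
`i = (p−1)/2`, read on the `χ_{ℚ(√p*)}`-eigenspace of `Sel_{p^∞}(E/ℚ(μ_{p^∞}))`:
`char_{Λ(Γ)} e_{(p−1)/2}X(E/ℚ(ζ_{p^∞})) ∋ u · L_p(E, ω^{(p−1)/2}, T)`.** As printed (Astérisque 295,
Thm. 17.4, p. 273): "Assume `f` has good ordinary reduction at `λ`. Let `T` be a `Gal(ℚ̄/ℚ)`-stable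
`O_λ`-lattice of `V_{F_λ}(f)`. (1) `X(T)` is a torsion `Λ`-module. […] (3) Let `α, ω, γ` be as in (2),
and assume that both `ω` and `γ` are good […] in the sense of 17.5 below. Assume further `p ≠ 2` and
that the condition 12.5.2 in 12.5 (4) is satisfied. Then `L_{p-adic,α,ω,γ}(f)` belongs to `Λ` and
`length_{Λ_𝔭}(X(T)_𝔭) ≤ ord_𝔭(L_{p-adic,α,ω,γ}(f))` for any prime ideal `𝔭` of `Λ` of height one" —
`Λ = O_λ⟦Gal(ℚ(ζ_{p^∞})/ℚ)⟧` (§12.1, §17.3), `X(T)` the dual of `lim_n Sel(ℚ(ζ_{p^n}), T(r))(−r)`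
(§17.3), (12.5.2) (p. 222) "the image of `Gal(ℚ̄/ℚ(ζ_{p^∞})) → GL₂(O_λ)` contains `SL₂(ℤ_p)`". For
`E/ℚ`, `p` odd, `T = T_pE(−1)`: `Λ = ⊕_{i=0}^{p−2} Λ(Γ)e_i` (`#Δ = p − 1` prime to `p`; Wuthrich 2014
§3 p. 390 "`M = ⊕ M_i` where `Δ` acts on `M_i` by the `i`-th power of the Teichmüller character"),
(12.1.1)–(12.1.3): `Λ = O_λ[Δ]⟦T⟧`, a product of rings indexed by the characters of `Δ`), the
height-one primes of `Λ` are those of the factors, and the printed inequality says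
`char_{Λ(Γ)}(e_iX) ∣ e_iL` for EACH `i`; this is the component `i = m = (p−1)/2`:
`e_mL = L_p(E, ω^m, T)` is the `ω^m`-branch of the Néron-normalised Mazur–Swinnerton-Dyer measure
(Thm. 16.2 with `ω` Néron, `γ` good; Mazur–Tate–Teitelbaum 1986 §I.13: on `[·]⁺` for `m` even, on
`[·]⁻` for `m` odd), i.e. `u·ϖ·B_m` with `ϖ·Ω_E = Ω⁺_f` (resp. `ϖ·|Ω⁻(E)| = Ω⁻_f`),
`B_m = padicLFunctionBranch f α m` (resp. `padicLFunctionMinusBranch f α m`), `α = unitRoot V p`,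
`u ∈ ℤ_p^×`. The module `e_mX` in the tree's subgroup model over `Γ_ℚ`: `κ` the cyclotomic
`ℤ_p`-extension of `ℚ`, `F = ℚ(ζ_p)`, `K = ℚ(√p*)` its quadratic subfield (`θ² = p*`),
`H = ker κ ⊓ Gal(ℚ̄/K) ⊓ Gal(ℚ̄/F)` (fixed field `ℚ_∞·K·F = ℚ(μ_{p^∞})`),
`Sel_∞(T) = Sel_{p^∞}(E/ℚ(μ_{p^∞})) = V.selmerGroupOver p H` (§14.1, §17.3; the identification of
the product sibling), `Δ` = the image of `Gal(ℚ̄/ℚ_∞) = ker κ` acting by `conjH1`,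
`ω^{(p−1)/2}(g) = +1` iff `g ∈ Gal(ℚ̄/K)` (the unique quadratic character of `Δ ≅ (ℤ/p)^×` cuts out
`K`), so `e_m Sel = S` := the Selmer classes `t` with `g_* t = t` (`g ∈ ker κ ∩ Gal(ℚ̄/K)`),
`g_* t = −t` (`g ∈ ker κ ∖ Gal(ℚ̄/K)`) — hypothesis `hS`; `X ≅ Hom(S, ℚ/ℤ)` a `Λ`-dual datum
field by field as in the tree's `SelmerDualData` (Greenberg LNM 1716 §1 p. 60), `T = γ − 1` for
`γ ∈ Gal(ℚ̄/K) ⊓ Gal(ℚ̄/F)` with `κ γ` the generator and `χ_p(γ)·ζ = 1 + p`, `ζ` torsion (hence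
`ζ = 1`: Kato's generator of `Γ = Gal(ℚ(μ_{p^∞})/F) ↔ 1 + pℤ_p`). Conclusion: `X` is `Λ`-torsion
(17.4 (1), direct summand) and `u·ϖ·B_m = ι g`, `g ∈ char_Λ X`, `u ∈ ℤ_p^×`,
`ι = iwasawaToPowerSeries p`. (12.5.2) is transcribed by the stronger "`ρ̄_{E,p^n}` surjective for all
`n`" (as in the product sibling). Component sibling of
`charIdeal_dvd_padicLFunction_cyclotomicPrime_of_surjective` (all `p − 1` components multiplied);
named fact, nothing asserted.
**RETIRED as a separate named fact (cell `b2b-bsdres`, referee ruling R118.3, 2026-08-20;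
deprecate-and-add):** this good-ordinary component reading is a KERNEL CONSEQUENCE of the general-`p`
semistable half-eigenspace reading
`Wuthrich2014.kato_halfEigenCharIdeal_dvd_cyclotomicPrime_of_surjective`
(`Wuthrich2014/SurjectiveDivisibilityCyclotomicPrimeHalf.lean`, p235488) — derivation
`Kato2004.charIdeal_dvd_padicLFunctionBranch_component_of_surjective_of_half`
(`BigImageDivisibilityCyclotomicPrimeComponentOfHalf.lean`, p236713). New consumers take the general
fact; existing consumers migrate to the `…_of_half` form when next touched; this `def` is kept verbatim
only until no module references it, then removed.
[cite: Kato2004Asterisque, Thm. 17.4 (3) (p. 273) with §17.3 (p. 273), §12.1 (12.1.1)–(12.1.4) (pp. 219–220), Thm. 12.5 (4) (12.5.2) (p. 222), §17.5 (p. 274), Thm. 16.2 (p. 269)]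
[cite: Wuthrich2014, §3 (p. 390)] [cite: MazurTateTeitelbaum1986Invent, §I.13]
[cite: GreenbergLNM1716, §1 (p. 60)] -/
def charIdeal_dvd_padicLFunctionBranch_component_of_surjective : Prop :=
  ∀ (p : ℕ) [Fact p.Prime] (V : WeierstrassCurve ℚ) [V.IsElliptic] [V.IsGloballyMinimal]
    (K : Type) [Field K] [NumberField K] [(galRange (K := ℚ) K).Normal]
    (F : Type) [Field F] [NumberField F] [IsCyclotomicExtension {p} ℚ F]
    [(galRange (K := ℚ) F).Normal]
    {κ : ZpExtension ℚ p} {γ : Field.absoluteGaloisGroup ℚ} {N : ℕ} [NeZero N]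
    {f : CuspForm (Gamma0 N) 2}
    (S : AddSubgroup (V.subgroupH1 p (κ.kerSubgroup ⊓ galRange (K := ℚ) K ⊓ galRange (K := ℚ) F)))
    (hSγ : ∀ t ∈ S, V.conjH1 p _ γ t ∈ S)
    (X : Type) [AddCommGroup X] [Module (IwasawaAlgebra p) X]
    (toDual : X →+ (S →+ AddCircle (1 : ℚ))),
    p ≠ 2 → Module.finrank ℚ K = 2 →
    (∃ θ : K, θ ^ 2 = algebraMap ℚ K ((-1) ^ (p / 2) * p)) →
    IsOrdinaryAt V p → (∀ n : ℕ, V.HasSurjectiveModNGaloisRep (p ^ n : ℕ)) →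
    κ.IsCyclotomic → κ.IsTopGenerator γ → IsCyclotomicVariable p γ →
    γ ∈ galRange (K := ℚ) K → γ ∈ galRange (K := ℚ) F →
    IsNewformOf V f →
    (∀ t, t ∈ S ↔
      t ∈ V.selmerGroupOver p (κ.kerSubgroup ⊓ galRange (K := ℚ) K ⊓ galRange (K := ℚ) F) ∧
        ∀ g ∈ κ.kerSubgroup,
          V.conjH1 p _ g t = if g ∈ galRange (K := ℚ) K then t else -t) →
    Function.Bijective toDual →
    (∀ (x : X) (s : S), toDual ((PowerSeries.X : IwasawaAlgebra p) • x) s =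
      toDual x ⟨V.conjH1 p _ γ s, hSγ s s.2⟩ - toDual x s) →
    (∀ (c : ℤ_[p]) (x : X) (s : S) (k : ℕ), (p ^ k) • s = 0 →
      toDual (PowerSeries.C c • x) s = (PadicInt.toZModPow k c).val • toDual x s) →
    ∀ (ϖ : ℚ),
      (if Even (p / 2) then (ϖ : ℝ) * V.realPeriodRat = plusPeriod f
        else (ϖ : ℝ) * V.imaginaryPeriodRat = minusPeriod f) →
      Module.IsTorsion (IwasawaAlgebra p) X ∧
      ∃ g ∈ Literature.NumberTheory.EllipticCurves.Module.charIdeal (IwasawaAlgebra p) X,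
        ∃ u : ℤ_[p]ˣ,
          iwasawaToPowerSeries p g =
            PowerSeries.C (((u : ℤ_[p]) : ℚ_[p]) * (ϖ : ℚ_[p])) *
              (if Even (p / 2) then padicLFunctionBranch f ((unitRoot V p : ℤ_[p]) : ℚ_[p]) (p / 2)
                else padicLFunctionMinusBranch f ((unitRoot V p : ℤ_[p]) : ℚ_[p]) (p / 2))

end Literature.NumberTheory.EllipticCurves.Kato2004

end
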